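import Literature.Computability.Learning.AmpPFunction
import Literature.Computability.Learning.AC0ModNWOutput
import Literature.Computability.MetaComplexity.GFDesignConcrete
import HarnessLib

/-!
# The NW outputs of the `AC⁰[p]` learner (odd `p`) are small `AC⁰[p]` circuits

Groundwork for the named fact `Literature.Computability.Learning.cikk_learn_AC0Mod` (CIKK 2016,
Cor. 5.4), all primes `p`: the step "`g_z ∈ Λ[s_g]`, hence by usefulness `¬D(g_z) = 1`" of the
proof of CIKK Thm. 5.1 (with Thm. 3.2, nonuniform `AC⁰[p]`-efficiency of the generator) for the
amplifier `AMP_p(f) = E^{vN} ∘ ((f^k)^{GL_p})^{2T}` of `AmpPFunction.lean` (CIKK Thm. 4.8) on the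
`AC⁰[p]`-computable design `designC` (`GFDesignConcrete.lean`, CIKK Thm. 3.6/3.7):

* `vnE_eq_true_iff` — von Neumann's function is `1` iff all pairs are equal or the first
  unequal pair `(a, b)` has `a > b`; `vnFormula` — the same as a depth-`4` formula over the
  indicator bits `[a_c = v]`, `vnFormula_indicator`, `acRealOver_vnFormula`;
* `blkG_eq_sum` — the GL symbol of a block is the `𝔽_p`-linear form `Σ_{i,e} 2^e [r̃ᵢ(e) ∧ f(xᵢ)]`,
  so each indicator `[blkG = v]` is ONE `MOD_p` gate over conjunctions (`acRealOver_blkInd`);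
* **`acRealOver_ampPFin_designC`** — for `f` computed by a circuit `C` over `accBasis p` and any
  seed `z`, the NW output `v ↦ AMP_p(f)(z|_{S_v})` is realized over `accBasis p` at depth
  `acDepth C + 11` with `ampPSize` gates (polynomial in all parameters);
* **`ampPNW_not_mem_rsProperty`** — hence (usefulness of the Razborov–Smolensky property,
  `not_mem_rsProperty_of_computes'`) every such output is REJECTED by `rsProperty p` at length
  `ℓ`, given `64((p-1)ℓ')^{2(d+11)} ≤ oddFloor ℓ` and `16 · ampPSize < p^{ℓ'}`.

## References

* M. Carmosino, R. Impagliazzo, V. Kabanets, A. Kolokolova, *Learning algorithms from natural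
  proofs*, CCC 2016, Thm. 3.2, Thm. 3.7, Def. 4.5 ("`E^{vN}` is computable in `AC⁰`"), Thm. 4.8,
  Thm. 5.1 (proof) [CarmosinoImpagliazzoKabanetsKolokolova2016].
-/

namespace Literature.Computability.Learning

open Finset Matrix Literature.Computability.Complexity Literature.Computability.MetaComplexity
  Literature.Computability.MetaComplexity.GFDesign Literature.Computability.MetaComplexity.Smolensky
  Literature.Computability.Cryptography

variable {p : ℕ} [hp : Fact p.Prime] {n k β T : ℕ}

/-! ### von Neumann's function as a flat formula -/

omit hp in
/-- **`E^{vN} = 1` iff all pairs are equal or the first unequal pair `(a, b)` has `a > b`.**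
[cite: CarmosinoImpagliazzoKabanetsKolokolova2016, Def. 4.5] -/
theorem vnE_eq_true_iff : ∀ (T : ℕ) (ā : Fin T → ZMod p × ZMod p),
    vnE T ā = true ↔ AllEq T ā ∨ ∃ j : Fin T, (∀ j' : Fin T, j' < j → (ā j').1 = (ā j').2) ∧ (ā j).2.val < (ā j).1.val
  | 0, ā => by
      have h0 : vnE 0 ā = true := rfl
      simp only [h0, true_iff]
      exact Or.inl fun j => j.elim0
  | T + 1, ā => by
      have hcons : vnE (T + 1) ā = vnL (ā 0 :: List.ofFn (Fin.tail ā)) := by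
        unfold vnE; rw [List.ofFn_succ]; rfl
      have htail : vnL (List.ofFn (Fin.tail ā)) = vnE T (Fin.tail ā) := rfl
      rw [hcons, vnL, htail]
      by_cases h0 : (ā 0).1 = (ā 0).2
      · rw [if_pos h0, vnE_eq_true_iff T (Fin.tail ā)]
        have hval0 : ¬ (ā 0).2.val < (ā 0).1.val := by rw [h0]; exact lt_irrefl _
        constructor
        · rintro (hall | ⟨j, hj, hgt⟩)
          · exact Or.inl (Fin.cases h0 (fun i => hall i))
          · refine Or.inr ⟨j.succ, ?_, hgt⟩
            intro j' hj'
            refine Fin.cases (motive := fun j' => j' < j.succ → (ā j').1 = (ā j').2) (fun _ => h0) (fun i hi => ?_) j' hj'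
            exact hj i (Fin.succ_lt_succ_iff.1 hi)
        · rintro (hall | ⟨j, hj, hgt⟩)
          · exact Or.inl fun i => hall i.succ
          · refine Fin.cases (motive := fun j => (∀ j' : Fin (T + 1), j' < j → (ā j').1 = (ā j').2) →
                (ā j).2.val < (ā j).1.val → _) (fun _ hgt0 => absurd hgt0 hval0) (fun i hi hgti => ?_) j hj hgt
            exact Or.inr ⟨i, fun i' hi' => hi i'.succ (Fin.succ_lt_succ_iff.2 hi'), hgti⟩
      · rw [if_neg h0, decide_eq_true_eq]
        constructor
        · intro hgt
          exact Or.inr ⟨0, fun j' hj' => absurd hj' (Fin.not_lt_zero j'), hgt⟩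
        · rintro (hall | ⟨j, hj, hgt⟩)
          · exact absurd (hall 0) h0
          · refine Fin.cases (motive := fun j => (∀ j' : Fin (T + 1), j' < j → (ā j').1 = (ā j').2) →
                (ā j).2.val < (ā j).1.val → _) (fun _ hgt0 => hgt0) (fun i hi _ => ?_) j hj hgt
            exact absurd (hi 0 (Fin.succ_pos i)) h0

variable (T)

/-- The two coordinates of pair `j` in a flat vector. [folklore] -/
def pfst (j : Fin T) : Fin (T * 2) := finProdFinEquiv (j, 0)

/-- The two coordinates of pair `j` in a flat vector. [folklore] -/
def psnd (j : Fin T) : Fin (T * 2) := finProdFinEquiv (j, 1)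

/-- Pair `j` is equal, read off the indicator bits `I c v = [a_c = v]`. [folklore] -/
def eqJ (I : Fin (T * 2) → ZMod p → Bool) (j : Fin T) : Prop := ∃ v : ZMod p, I (pfst T j) v = true ∧ I (psnd T j) v = true

/-- Pair `j` is strictly decreasing (`a > b`), read off the indicator bits. [folklore] -/
def gtJ (I : Fin (T * 2) → ZMod p → Bool) (j : Fin T) : Prop :=
  ∃ vw : ZMod p × ZMod p, vw.2.val < vw.1.val ∧ I (pfst T j) vw.1 = true ∧ I (psnd T j) vw.2 = true

omit hp in
/-- `eqJ` is decidable. [folklore] -/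
instance [NeZero p] (I : Fin (T * 2) → ZMod p → Bool) (j : Fin T) : Decidable (eqJ T I j) := by
  unfold eqJ; infer_instance

omit hp in
/-- `gtJ` is decidable. [folklore] -/
instance [NeZero p] (I : Fin (T * 2) → ZMod p → Bool) (j : Fin T) : Decidable (gtJ T I j) := by
  unfold gtJ; infer_instance

/-- **`E^{vN}` as a depth-4 formula over the indicator bits.** [cite: CarmosinoImpagliazzoKabanetsKolokolova2016, Def. 4.5 ("It is not hard to see that `E^{vN}` is computable in `AC⁰`")] -/
def vnFormula (I : Fin (T * 2) → ZMod p → Bool) : Prop :=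
  (∀ j : Fin T, eqJ T I j) ∨ ∃ j : Fin T, (∀ j' : Fin (j : ℕ), eqJ T I (j'.castLE (le_of_lt j.isLt))) ∧ gtJ T I j

omit hp in
/-- `vnFormula` is decidable. [folklore] -/
instance [NeZero p] (I : Fin (T * 2) → ZMod p → Bool) : Decidable (vnFormula T I) := by
  unfold vnFormula; infer_instance

/-- The indicator bits of a vector. [folklore] -/
def indic (a : Fin (T * 2) → ZMod p) : Fin (T * 2) → ZMod p → Bool := fun c v => decide (a c = v)

omit hp in
/-- `eqJ` on indicator bits. [folklore] -/
theorem eqJ_indic (a : Fin (T * 2) → ZMod p) (j : Fin T) : eqJ T (indic T a) j ↔ a (pfst T j) = a (psnd T j) := by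
  unfold eqJ indic
  simp only [decide_eq_true_eq]
  constructor
  · rintro ⟨v, h1, h2⟩; rw [h1, h2]
  · intro h; exact ⟨a (pfst T j), rfl, h.symm⟩

omit hp in
/-- `gtJ` on indicator bits. [folklore] -/
theorem gtJ_indic (a : Fin (T * 2) → ZMod p) (j : Fin T) :
    gtJ T (indic T a) j ↔ (a (psnd T j)).val < (a (pfst T j)).val := by
  unfold gtJ indic
  simp only [decide_eq_true_eq]
  constructor
  · rintro ⟨vw, h, h1, h2⟩; rw [h1, h2]; exact h
  · intro h; exact ⟨(a (pfst T j), a (psnd T j)), h, rfl, rfl⟩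

omit hp in
/-- **The formula computes `E^{vN}` on indicator bits.** [cite: CarmosinoImpagliazzoKabanetsKolokolova2016, Def. 4.5] -/
theorem vnFormula_indic (a : Fin (T * 2) → ZMod p) : vnFormula T (indic T a) ↔ vnE2 T a = true := by
  unfold vnE2
  rw [vnE_eq_true_iff]
  have hpair : ∀ j : Fin T, pairUp T a j = (a (pfst T j), a (psnd T j)) := fun j => rfl
  unfold vnFormula AllEq
  simp only [eqJ_indic, gtJ_indic, hpair]
  apply or_congr Iff.rfl
  refine exists_congr fun j => and_congr ?_ Iff.rfl
  constructor
  · intro h j' hj'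
    have := h ⟨j', hj'⟩
    simpa using this
  · intro h j'
    exact h (j'.castLE (le_of_lt j.isLt)) (by simp [Fin.lt_def])

/-! ### Realizing the formula -/

/-- The indicator bits as inputs indexed by `Fin (T·2·p)`. [folklore] -/
def indIdx (p T : ℕ) [NeZero p] (c : Fin (T * 2)) (v : ZMod p) : Fin (T * 2 * p) :=
  finProdFinEquiv (c, (ZMod.finEquiv p).symm v)

/-- `E^{vN}` as a function of the `T·2·p` indicator inputs. [folklore] -/
def vnFormulaFin (p T : ℕ) [NeZero p] (u : Fin (T * 2 * p) → Bool) : Bool :=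
  decide (vnFormula T (p := p) fun c v => u (indIdx p T c v))

/-- The size of the `E^{vN}` formula. [folklore] -/
def vnSize (T p : ℕ) : ℕ := (T * (p + 1) + 1) + T * ((T * (p + 1) + 1) + (p * p * 3 + 1) + 1) + 1

/-- **`E^{vN}` over the indicator inputs is realized at depth `4` over `acBasis`.**
[cite: CarmosinoImpagliazzoKabanetsKolokolova2016, Def. 4.5 ("computable in `AC⁰`")] -/
theorem acRealOver_vnFormulaFin {B : Set GateFn} (hB : acBasis ⊆ B) :
    ACRealOver B (vnFormulaFin p T) 4 (vnSize T p) := by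
  -- literals
  have hlit : ∀ (c : Fin (T * 2)) (v : ZMod p),
      ACRealOver B (fun u : Fin (T * 2 * p) → Bool => u (indIdx p T c v)) 0 0 := fun c v => acRealOver_input B _
  -- `eqJ` at depth 2, size `p · 3 + 1`
  have heq : ∀ j : Fin T, ACRealOver B (fun u : Fin (T * 2 * p) → Bool =>
      decide (eqJ T (p := p) (fun c v => u (indIdx p T c v)) j)) 2 (p + 1) := by
    intro j
    have hand : ∀ v : ZMod p, ACRealOver B (fun u : Fin (T * 2 * p) → Bool =>
        u (indIdx p T (pfst T j) v) && u (indIdx p T (psnd T j) v)) 1 (0 + 0 + 1) := fun v =>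
      acRealOver_and₂ hB (hlit _ v) (hlit _ v)
    have h := acRealOver_exists hB (M := p) (f := fun (m : Fin p) (u : Fin (T * 2 * p) → Bool) =>
      u (indIdx p T (pfst T j) (ZMod.finEquiv p m)) && u (indIdx p T (psnd T j) (ZMod.finEquiv p m)))
      (fun m => hand (ZMod.finEquiv p m))
    refine (h.mono le_rfl (le_of_eq ?_)).congr fun u => ?_
    · simp
    · unfold eqJ
      simp only [Bool.and_eq_true, decide_eq_decide]
      constructor
      · rintro ⟨m, hm⟩; exact ⟨ZMod.finEquiv p m, hm⟩
      · rintro ⟨v, hv⟩; exact ⟨(ZMod.finEquiv p).symm v, by simpa using hv⟩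
  -- `gtJ` at depth 2, size `p² · 3 + 1`
  have hgt : ∀ j : Fin T, ACRealOver B (fun u : Fin (T * 2 * p) → Bool =>
      decide (gtJ T (p := p) (fun c v => u (indIdx p T c v)) j)) 2 (p * p * 3 + 1) := by
    intro j
    set e2 : Fin (p * p) ≃ ZMod p × ZMod p := finProdFinEquiv.symm.trans
      (Equiv.prodCongr (ZMod.finEquiv p).toEquiv (ZMod.finEquiv p).toEquiv) with he2
    have hand : ∀ m : Fin (p * p), ACRealOver B (fun u : Fin (T * 2 * p) → Bool =>
        decide ((e2 m).2.val < (e2 m).1.val) &&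
          (u (indIdx p T (pfst T j) (e2 m).1) && u (indIdx p T (psnd T j) (e2 m).2))) 1 3 := by
      intro m
      by_cases hm : (e2 m).2.val < (e2 m).1.val
      · simp only [hm, decide_true, Bool.true_and]
        exact (acRealOver_and₂ hB (hlit _ _) (hlit _ _)).mono le_rfl (by norm_num)
      · simp only [hm, decide_false, Bool.false_and]
        exact (acRealOver_const hB false).mono le_rfl (by norm_num)
    have h := acRealOver_exists hB (M := p * p) hand
    refine (h.mono le_rfl (le_of_eq ?_)).congr fun u => ?_
    · simp
    · unfold gtJ
      simp only [Bool.and_eq_true, decide_eq_true_eq, decide_eq_decide]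
      constructor
      · rintro ⟨m, hm, h1, h2⟩; exact ⟨e2 m, hm, h1, h2⟩
      · rintro ⟨vw, hm, h1, h2⟩; exact ⟨e2.symm vw, by simpa using hm, by simpa using h1, by simpa using h2⟩
  -- all equal, depth 3
  have hall : ACRealOver B (fun u : Fin (T * 2 * p) → Bool =>
      decide (∀ j : Fin T, eqJ T (p := p) (fun c v => u (indIdx p T c v)) j)) 3 (T * (p + 1) + 1) := by
    refine (acRealOver_forall_const hB heq).congr fun u => ?_
    simp only [decide_eq_true_eq]
  -- the `j`-th disjunct, depth 3: ONE conjunction over the `eqJ j'` (`j' < j`) and `gtJ j`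
  have hdis : ∀ j : Fin T, ACRealOver B (fun u : Fin (T * 2 * p) → Bool =>
      decide ((∀ j' : Fin (j : ℕ), eqJ T (p := p) (fun c v => u (indIdx p T c v)) (j'.castLE (le_of_lt j.isLt))) ∧
        gtJ T (p := p) (fun c v => u (indIdx p T c v)) j)) 3 ((T * (p + 1) + 1) + (p * p * 3 + 1) + 1) := by
    intro j
    have hfam : ∀ m : Fin ((j : ℕ) + 1), ACRealOver B
        (Fin.lastCases (fun u : Fin (T * 2 * p) → Bool => decide (gtJ T (p := p) (fun c v => u (indIdx p T c v)) j))
          (fun j' u => decide (eqJ T (p := p) (fun c v => u (indIdx p T c v)) (j'.castLE (le_of_lt j.isLt)))) m)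
        2 (Fin.lastCases (p * p * 3 + 1) (fun _ => p + 1) m) := by
      intro m
      refine Fin.lastCases ?_ (fun j' => ?_) m
      · simp only [Fin.lastCases_last]; exact hgt j
      · simp only [Fin.lastCases_castSucc]; exact heq _
    have h := acRealOver_forall hB hfam
    refine (h.mono le_rfl ?_).congr fun u => ?_
    · rw [Fin.sum_univ_castSucc]
      simp only [Fin.lastCases_castSucc, Fin.lastCases_last, Finset.sum_const, Finset.card_univ, Fintype.card_fin,
        smul_eq_mul]
      have hj : (j : ℕ) * (p + 1) ≤ T * (p + 1) := Nat.mul_le_mul_right _ (le_of_lt j.isLt)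
      omega
    · rw [decide_eq_decide, Fin.forall_fin_succ']
      simp only [Fin.lastCases_castSucc, Fin.lastCases_last, decide_eq_true_eq]
  -- the disjunction over `j` and the all-equal term, depth 4
  have hfam : ∀ m : Fin (T + 1), ACRealOver B
      (Fin.lastCases (fun u : Fin (T * 2 * p) → Bool => decide (∀ j : Fin T, eqJ T (p := p) (fun c v => u (indIdx p T c v)) j))
        (fun j u => decide ((∀ j' : Fin (j : ℕ), eqJ T (p := p) (fun c v => u (indIdx p T c v)) (j'.castLE (le_of_lt j.isLt))) ∧
          gtJ T (p := p) (fun c v => u (indIdx p T c v)) j)) m)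
      3 (Fin.lastCases (T * (p + 1) + 1) (fun _ => (T * (p + 1) + 1) + (p * p * 3 + 1) + 1) m) := by
    intro m
    refine Fin.lastCases ?_ (fun j => ?_) m
    · simp only [Fin.lastCases_last]; exact hall
    · simp only [Fin.lastCases_castSucc]; exact hdis j
  have h := acRealOver_exists hB hfam
  refine (h.mono le_rfl (le_of_eq ?_)).congr fun u => ?_
  · rw [Fin.sum_univ_castSucc]
    simp only [Fin.lastCases_castSucc, Fin.lastCases_last, Finset.sum_const, Finset.card_univ, Fintype.card_fin,
      smul_eq_mul, vnSize]
    ring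
  · unfold vnFormulaFin vnFormula
    rw [decide_eq_decide, Fin.exists_fin_succ']
    simp only [Fin.lastCases_castSucc, Fin.lastCases_last, decide_eq_true_eq]
    exact or_comm

/-! ### The GL symbol of a block is a linear form in the literals `r̃ᵢ(e) ∧ f(xᵢ)` -/

omit hp in
/-- The value of a position is `Σ_e [r̃(e)] 2^e`. [folklore] -/
theorem posVal_eq_sum (y : Fin β → Bool) : posVal y = ∑ e : Fin β, (y e).toNat * 2 ^ (e : ℕ) := by
  rw [posVal, boolFunEquivFin, Equiv.trans_apply, finFunctionFinEquiv_apply]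
  refine Finset.sum_congr rfl fun j _ => ?_
  simp only [Equiv.arrowCongr_apply, Equiv.refl_symm, Equiv.coe_refl, Function.comp_apply, id_eq]
  cases y j <;> rfl

/-- **`blkG = Σᵢ Σ_e 2^e · [r̃ᵢ(e) ∧ f(xᵢ)]` in `𝔽_p`.** [cite: CarmosinoImpagliazzoKabanetsKolokolova2016, §4.2] -/
theorem blkG_eq_sum (g : (Fin n → Bool) → Bool) (b : Blk n k β) :
    blkG p g b = ∑ i : Fin k, ∑ e : Fin β, if (b.2 i e && g (b.1 i)) = true then ((2 : ZMod p) ^ (e : ℕ)) else 0 := by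
  unfold blkG dpGLP
  change ∑ i : Fin k, dpVecP g b.1 i * ((posVal (b.2 i) : ℕ) : ZMod p) = _
  refine Finset.sum_congr rfl fun i _ => ?_
  rw [posVal_eq_sum, Nat.cast_sum, Finset.mul_sum]
  refine Finset.sum_congr rfl fun e _ => ?_
  simp only [dpVecP]
  cases b.2 i e <;> cases g (b.1 i) <;> simp

/-! ### The NW output of the learner as an `AC⁰[p]` circuit -/

section Circuit

variable {T} {t ℓ : ℕ}

/-- The size of one indicator `[blkG = v]` over the design. [folklore] -/
def indSize (n k β ℓ t p s : ℕ) : ℕ :=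
  (k * β + 1) * (p - 1) + 2 + k * β * (coordSize (p ^ t) t ℓ p + (s + n * coordSize (p ^ t) t ℓ p) + 1)

/-- **The size of the NW output circuit** `v ↦ AMP_p(f)(z|_{S_v})`. [folklore] -/
def ampPSize (n k β T ℓ t p s : ℕ) : ℕ := vnSize T p + T * 2 * p * indSize n k β ℓ t p s

omit hp in
/-- `indSize` is monotone in the circuit size. [folklore] -/
theorem indSize_mono {s s' : ℕ} (h : s ≤ s') : indSize n k β ℓ t p s ≤ indSize n k β ℓ t p s' := by
  unfold indSize; gcongr

omit hp in
/-- `ampPSize` is monotone in the circuit size. [folklore] -/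
theorem ampPSize_mono {s s' : ℕ} (h : s ≤ s') : ampPSize n k β T ℓ t p s ≤ ampPSize n k β T ℓ t p s' := by
  unfold ampPSize; exact Nat.add_le_add_left (Nat.mul_le_mul_left _ (indSize_mono h)) _

variable (ht : t ≠ 0) (hN : T * 2 * (k * n + k * β) ≤ p ^ t) (C : Circuit (Fin n)) (hC : C.IsOver (accBasis p))
  (z : Fin (p ^ t * p ^ t) → Bool)

/-- The input of `AMP_p(f)` read off the seed through the design, at seed part `v`. [folklore] -/
noncomputable def wv (v : Fin ℓ → Bool) : AmpPIdx n k β T → Bool :=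
  fun q => z (designC p ht (T * 2 * (k * n + k * β)) ℓ hN v (ampPIdxEquiv n k β T q))

include hC in
/-- **One indicator `[blkG(block c) = val]` is realized at depth `acDepth C + 7`**: a `MOD_p` gate
(linear test) over the conjunctions `r̃ᵢ(e) ∧ C(xᵢ)`, each reading design coordinates.
[cite: CarmosinoImpagliazzoKabanetsKolokolova2016, Thm. 3.2 (proof), §3.1 footnote 4] -/
theorem acRealOver_blkInd (c : Fin (T * 2)) (val : ZMod p) :
    ACRealOver (accBasis p)
      (fun v : Fin ℓ → Bool => decide (blkG p (fun x => C.eval x) (blkOf (wv ht hN z v) c) = val))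
      (C.acDepth + 7) (indSize n k β ℓ t p C.size) := by
  set S₄ := coordSize (p ^ t) t ℓ p with hS₄
  set e := ampPIdxEquiv n k β T with he
  have hcoord : ∀ q : AmpPIdx n k β T, ACRealOver (accBasis p) (fun v : Fin ℓ → Bool => wv ht hN z v q) 4 S₄ :=
    fun q => acRealOver_designC p ht hN z (e q)
  -- the literals `r̃ᵢ(e) ∧ C(xᵢ)`
  have hlit : ∀ ie : Fin k × Fin β, ACRealOver (accBasis p)
      (fun v : Fin ℓ → Bool => (blkOf (wv ht hN z v) c).2 ie.1 ie.2 && C.eval ((blkOf (wv ht hN z v) c).1 ie.1))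
      (C.acDepth + 5) (S₄ + (C.size + n * S₄) + 1) := by
    intro ie
    have hX := acRealOver_circuit_comp C hC (fun j => hcoord (c, Sum.inl (ie.1, j)))
    have hR := (hcoord (c, Sum.inr (ie.1, ie.2))).mono (Nat.le_add_left 4 C.acDepth) le_rfl
    refine ((acRealOver_and₂ (acBasis_subset_accBasis p) hR hX).mono le_rfl (le_of_eq ?_)).congr fun v => rfl
    simp only [Finset.sum_const, Finset.card_univ, Fintype.card_fin, smul_eq_mul]
  -- the linear test over the `k·β` literals
  set a : Fin (k * β) → ZMod p := fun j => (2 : ZMod p) ^ ((finProdFinEquiv.symm j).2 : ℕ) with ha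
  have hlin := acRealOver_linTest (ℓ := k * β) a val
  have hcomp := hlin.comp (f := fun j (v : Fin ℓ → Bool) =>
      (blkOf (wv ht hN z v) c).2 (finProdFinEquiv.symm j).1 (finProdFinEquiv.symm j).2 &&
        C.eval ((blkOf (wv ht hN z v) c).1 (finProdFinEquiv.symm j).1))
    (fun j => hlit (finProdFinEquiv.symm j))
  have hsum : ∀ v : Fin ℓ → Bool, blkG p (fun x => C.eval x) (blkOf (wv ht hN z v) c) =
      ∑ j : Fin (k * β), (if ((blkOf (wv ht hN z v) c).2 (finProdFinEquiv.symm j).1 (finProdFinEquiv.symm j).2 &&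
        C.eval ((blkOf (wv ht hN z v) c).1 (finProdFinEquiv.symm j).1)) = true then a j else 0) := by
    intro v
    rw [blkG_eq_sum, ← Fintype.sum_prod_type']
    exact Fintype.sum_equiv finProdFinEquiv _ _ fun ie => by simp only [ha, Equiv.symm_apply_apply]
  refine (hcomp.mono (by omega) (le_of_eq ?_)).congr fun v => ?_
  · simp only [Finset.sum_const, Finset.card_univ, Fintype.card_fin, smul_eq_mul, indSize, hS₄]
  · rw [hsum v]

include hC in
/-- **The NW output `g_z(v) = AMP_p(f)(z|_{S_v})` is a small `AC⁰[p]` circuit** (CIKK Fig. 1 with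
Thm. 3.7 and Thm. 4.8): realized over `accBasis p` at depth `acDepth C + 11` with `ampPSize`
gates. [cite: CarmosinoImpagliazzoKabanetsKolokolova2016, Thm. 3.2 (proof: nonuniform `AC⁰[p]`-efficiency)] -/
theorem acRealOver_ampPFin_designC :
    ACRealOver (accBasis p)
      (fun v : Fin ℓ → Bool => ampPFin p (fun x => C.eval x) k β T fun pos =>
        z (designC p ht (T * 2 * (k * n + k * β)) ℓ hN v pos))
      (C.acDepth + 11) (ampPSize n k β T ℓ t p C.size) := by
  have hvn := acRealOver_vnFormulaFin (p := p) T (acBasis_subset_accBasis p)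
  have hcomp := hvn.comp (f := fun idx (v : Fin ℓ → Bool) =>
      decide (blkG p (fun x => C.eval x) (blkOf (wv ht hN z v) (finProdFinEquiv.symm idx).1) =
        ZMod.finEquiv p (finProdFinEquiv.symm idx).2))
    (fun idx => acRealOver_blkInd ht hN C hC z _ _)
  refine (hcomp.mono (by omega) (le_of_eq ?_)).congr fun v => ?_
  · simp only [Finset.sum_const, Finset.card_univ, Fintype.card_fin, smul_eq_mul, ampPSize]
  · -- both sides are `E^{vN}` of the block symbols
    have hamp : ampPFin p (fun x => C.eval x) k β T (fun pos => z (designC p ht (T * 2 * (k * n + k * β)) ℓ hN v pos)) =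
        vnE2 T (fun c => blkG p (fun x => C.eval x) (blkOf (wv ht hN z v) c)) := rfl
    rw [hamp, vnFormulaFin]
    set a : Fin (T * 2) → ZMod p := fun c => blkG p (fun x => C.eval x) (blkOf (wv ht hN z v) c) with ha
    have hI : (fun c val => decide (blkG p (fun x => C.eval x) (blkOf (wv ht hN z v) (finProdFinEquiv.symm (indIdx p T c val)).1) =
        ZMod.finEquiv p (finProdFinEquiv.symm (indIdx p T c val)).2)) = indic T a := by
      funext c val
      simp [indIdx, indic, ha]
    rw [hI]
    rw [Bool.eq_iff_iff, decide_eq_true_eq]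
    exact vnFormula_indic T a

include hC in
/-- **Every NW output of the `AC⁰[p]` learner is rejected by the Razborov–Smolensky property**
(CIKK, proof of Thm. 5.1: "by usefulness, `Pr_z[¬D(g_z) = 1] = 1`", for `Λ = AC⁰[p]` with the
property `rsProperty p` and explicit parameters): if `f` has a circuit over `accBasis p` of
`acDepth ≤ d` and size `≤ s`, then for every seed `z` the output `g_z` at length `ℓ ≥ 1` is not in
`rsProperty p ℓ`, provided some `ℓ' ≥ 1` has `64 ((p-1)ℓ')^{2(d+11)} ≤ oddFloor ℓ` and
`16 · ampPSize < p^{ℓ'}`. [cite: CarmosinoImpagliazzoKabanetsKolokolova2016, Thm. 5.1 (proof)] -/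
theorem ampPNW_not_mem_rsProperty {d s : ℕ} (hd : C.acDepth ≤ d) (hs : C.size ≤ s) (hℓ : 1 ≤ ℓ) {ℓ' : ℕ}
    (hℓ' : 1 ≤ ℓ') (hdeg : 64 * ((p - 1) * ℓ') ^ (2 * (d + 11)) ≤ oddFloor ℓ)
    (hsize : 16 * ampPSize n k β T ℓ t p s < p ^ ℓ') :
    (fun v : Fin ℓ → Bool => ampPFin p (fun x => C.eval x) k β T fun pos =>
        z (designC p ht (T * 2 * (k * n + k * β)) ℓ hN v pos)) ∉ rsProperty p ℓ := by
  have hreal := (acRealOver_ampPFin_designC (ℓ := ℓ) ht hN C hC z).mono (Nat.add_le_add_right hd 11) (ampPSize_mono hs)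
  obtain ⟨C', hO, hD, hS, hcomp⟩ := hreal.toCircuit
  refine not_mem_rsProperty_of_computes' hℓ C' hO hD hcomp hℓ' hdeg ?_
  exact lt_of_le_of_lt (Nat.mul_le_mul_left 16 hS) hsize

end Circuit

end Literature.Computability.Learning
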